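import Summits.AtomisticToContinuum.HydrodynamicLimit.Theorems.JParityClosureParityBandClosurePressureValueAlgebra
import Literature.Analysis.FluidPDE.HardSphereCollisionRecord
import Literature.Analysis.FluidPDE.HardSphereFlowRegular
import HarnessLib

/-!
# `EvenStressEnskog` + weak stress isotropy ⇒ the collisional pressure value — part B: along one good orbit

Helper for the line `Sketch` of the crux `JParityClosure.ParityBandClosure` (stmt-AtomisticToContinuum-17608), stub
`stub_pressureValueOfEvenStress`.  For ONE hard-sphere flow `Φ` and ONE good initial datum `z`:

* `integrable_continuous_flow` — a continuous function of `(s, x, Φ_s z)` is integrable over `𝕋³` at every time and its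
  `𝕋³`-integral is integrable in time on every window (orbit measurable in time, `measurable_flow_of_mem_good`; bounded
  on the compact set of configurations of conserved kinetic energy, `HardSphereFlow.configEnergy_flow`);
* `cpvCollision_eq_sum` — MARK MATCHING: on the good set every recorded contact pair is post-collisional
  (`IsHardSphereTrajectory.isOutgoing_of_mem_contactSet`), so the recovered pre-collisional pair `reflectVel n (vᵢ, vⱼ)`
  approaches, `((vⱼ⁻ − vᵢ⁻)·n̂)₊ = |(vᵢ⁻ − vⱼ⁻)·n̂|`, and the collision functional of the stress mark
  `g(σ³ρ_r)|(vᵢ⁻ − vⱼ⁻)·n̂| (n̂⊗n̂ : a)` of `CollisionalPressureValueInBand` is the sum over `(k, l)` of the collision sums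
  of `EvenStressEnskog` with weights `χ = a_{kl}` (finitely many collision times, `locFinite`);
* `wsiIntegrand_eq_wsiPoly`, `continuous_wsiPoly` — the weak-isotropy integrand with the cut-off `b⁺ g Ỹ` for the
  traceless part of `a` is a polynomial in the cone weights and velocities, jointly continuous in `(s, x, w)`.

References: C. Cercignani, R. Illner, M. Pulvirenti, *The Mathematical Theory of Dilute Gases* (1994) §4.2 (good set,
pre- and post-collisional pairs); S. Chapman, T. G. Cowling (1970) §16.4.
-/

noncomputable section

namespace Summit.AtomisticToContinuum.HydrodynamicLimit.Theorems.ParityBandClosurePressureValue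

open scoped BigOperators InnerProductSpace ENNReal Topology
open MeasureTheory Set Filter
open Literature.MathematicalPhysics.KineticTheory Literature.Analysis.FluidPDE

variable {N : ℕ}

/-! ## Integrability along a good orbit of continuous functions of `(s, x, Φ_s z)` -/

/-- Velocities along a good orbit are bounded by the conserved kinetic energy: `‖vᵢ(s)‖ ≤ √(2E(z))`. [folklore] -/
theorem norm_vel_flow_le {σ : ℝ} (Φ : HardSphereFlow (Torus.geometry (Fin 3)) (hsDiameter σ N) (N + 1))
    {z : Config (N + 1) (Fin 3) T3} (hz : z ∈ Φ.good) (s : ℝ) (i : Fin (N + 1)) :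
    ‖(Φ.flow s z i).2‖ ≤ Real.sqrt (2 * configEnergy z) := by
  refine Real.le_sqrt_of_sq_le ?_
  rw [← Φ.configEnergy_flow hz s]
  unfold configEnergy
  have h : ‖(Φ.flow s z i).2‖ ^ 2 ≤ ∑ j, ‖(Φ.flow s z j).2‖ ^ 2 :=
    Finset.single_le_sum (f := fun j => ‖(Φ.flow s z j).2‖ ^ 2) (fun j _ => by positivity) (Finset.mem_univ i)
  linarith

/-- **Integrability along a good orbit.** For a continuous `Ψ(s, x, w)` and a good initial datum `z`: at every time
`x ↦ Ψ(s, x, Φ_s z)` is integrable over `𝕋³`, and `s ↦ ∫ Ψ(s, x, Φ_s z) dx` is integrable on every window `[0, t]`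
(measurable by Fubini measurability along the measurable orbit, bounded on the compact set of configurations with the
conserved kinetic energy). [folklore] -/
theorem integrable_continuous_flow {σ : ℝ} (Φ : HardSphereFlow (Torus.geometry (Fin 3)) (hsDiameter σ N) (N + 1))
    {z : Config (N + 1) (Fin 3) T3} (hz : z ∈ Φ.good) {Ψ : ℝ × T3 × Config (N + 1) (Fin 3) T3 → ℝ}
    (hΨ : Continuous Ψ) (t : ℝ) :
    (∀ s, Integrable fun x => Ψ (s, x, Φ.flow s z)) ∧
      IntegrableOn (fun s => ∫ x, Ψ (s, x, Φ.flow s z)) (Icc 0 t) := by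
  have hx : ∀ s, Integrable fun x => Ψ (s, x, Φ.flow s z) := fun s => by
    have hc : Continuous fun x => Ψ (s, x, Φ.flow s z) := by fun_prop
    exact hc.integrable_of_hasCompactSupport (isClosed_tsupport _).isCompact
  refine ⟨hx, ?_⟩
  -- measurability in time
  have hm1 : Measurable fun p : ℝ × T3 => Ψ (p.1, p.2, Φ.flow p.1 z) :=
    hΨ.measurable.comp (measurable_fst.prodMk (measurable_snd.prodMk
      ((measurable_flow_of_mem_good Φ hz).comp measurable_fst)))
  have hm2 : StronglyMeasurable fun s : ℝ => ∫ x, Ψ (s, x, Φ.flow s z) :=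
    hm1.stronglyMeasurable.integral_prod_right' (ν := volume)
  -- the compact set visited
  set R : ℝ := Real.sqrt (2 * configEnergy z)
  set K : Set (ℝ × T3 × Config (N + 1) (Fin 3) T3) :=
    Icc 0 t ×ˢ ((univ : Set T3) ×ˢ univ.pi fun _ : Fin (N + 1) => (univ : Set T3) ×ˢ Metric.closedBall (0 : V3) R)
  have hK : IsCompact K :=
    isCompact_Icc.prod (isCompact_univ.prod (isCompact_univ_pi fun _ =>
      isCompact_univ.prod (isCompact_closedBall (0 : V3) R)))
  obtain ⟨C, hC⟩ := hK.exists_bound_of_continuousOn hΨ.continuousOn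
  have hmem : ∀ s ∈ Icc (0 : ℝ) t, ∀ x : T3, (s, x, Φ.flow s z) ∈ K := fun s hs x =>
    ⟨hs, mem_univ _, fun i _ => ⟨mem_univ _, by
      rw [Metric.mem_closedBall, dist_zero_right]
      exact norm_vel_flow_le Φ hz s i⟩⟩
  refine Integrable.of_bound hm2.aestronglyMeasurable C ?_
  filter_upwards [ae_restrict_mem measurableSet_Icc] with s hs
  have hb : ∀ x, ‖Ψ (s, x, Φ.flow s z)‖ ≤ C := fun x => hC _ (hmem s hs x)
  have h := norm_integral_le_of_norm_le_const (μ := (volume : Measure T3)) (ae_of_all _ hb)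
  rwa [show (volume : Measure T3).real univ = 1 from probReal_univ, mul_one] at h

/-! ## Joint continuity of the cone fields -/

/-- The cone kernel composed with continuous maps is continuous (`Torus.continuous_euclidDist`). [folklore] -/
theorem continuous_coneKernel_comp' {α : Type*} [TopologicalSpace α] (r : ℝ) {f g : α → T3} (hf : Continuous f)
    (hg : Continuous g) : Continuous fun a => coneKernel r (f a) (g a) := by
  have h : Continuous fun a => Torus.euclidDist (f a) (g a) := by
    simpa only [Function.comp_def] using Torus.continuous_euclidDist.comp (hf.prodMk hg)
  unfold coneKernel
  exact continuous_const.mul ((continuous_const.sub (h.div_const r)).max continuous_const)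

attribute [local fun_prop] continuous_coneKernel_comp'

/-- `(w, x) ↦ ρ_r(w, x)` composed with continuous maps is continuous. [folklore] -/
theorem continuous_mollDensity_comp' {α : Type*} [TopologicalSpace α] (r : ℝ)
    {w : α → Config (N + 1) (Fin 3) T3} {x : α → T3} (hw : Continuous w) (hx : Continuous x) :
    Continuous fun a => mollDensity r (w a) (x a) := by
  simp only [mollDensity_eq_avg]
  fun_prop

/-- `(w, x) ↦ (m_r)_k(w, x)` composed with continuous maps is continuous. [folklore] -/
theorem continuous_mollMomentum_apply_comp {α : Type*} [TopologicalSpace α] (r : ℝ)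
    {w : α → Config (N + 1) (Fin 3) T3} {x : α → T3} (hw : Continuous w) (hx : Continuous x) (k : Fin 3) :
    Continuous fun a => mollMomentum r (w a) (x a) k := by
  simp only [mollMomentum_apply_eq_sum]
  fun_prop

/-- `(w, x) ↦ S_{jk}(w, x) = ∫ b_r v_j v_k dμ_w` composed with continuous maps is continuous. [folklore] -/
theorem continuous_secondMoment_comp {α : Type*} [TopologicalSpace α] (r : ℝ)
    {w : α → Config (N + 1) (Fin 3) T3} {x : α → T3} (hw : Continuous w) (hx : Continuous x) (j k : Fin 3) :
    Continuous fun a => ∫ q, coneKernel r q.1 (x a) * (q.2 j * q.2 k) ∂(empiricalMeasure (w a)) := by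
  simp only [secondMoment_eq_sum]
  fun_prop

attribute [local fun_prop] continuous_mollDensity_comp' continuous_mollMomentum_apply_comp continuous_secondMoment_comp

/-! ## The weak-isotropy integrand in polynomial form -/

/-- **The weak-isotropy integrand of `WeakStressIsotropyInBand` for the traceless part of `a` and the cut-off
`g̃(b) = b⁺ g(b) Ỹ(b)` is a polynomial** `σ³ g Ỹ Σ_{jk} a⁰_{jk}(ρ_r S_{jk} − m_j m_k)` in the cone weights and velocities
(`0 < σ`, `0 < r`: `ρ_r ≥ 0` and `ρ_r P = ρ_r S − m ⊗ m`, no division). [folklore] -/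
theorem wsiIntegrand_eq_wsiPoly {σ r : ℝ} (hσ : 0 < σ) (hr : 0 < r) (a : Fin 3 → Fin 3 → ℝ × T3 → ℝ)
    (g Yt : ℝ → ℝ) (s : ℝ) (x : T3) (w : Config (N + 1) (Fin 3) T3) :
    max (σ ^ 3 * mollDensity r w x) 0 * g (σ ^ 3 * mollDensity r w x) * Yt (σ ^ 3 * mollDensity r w x) * ∑ j, ∑ k, (a j k (s, x) - if j = k then (∑ i, a i i (s, x)) / 3 else 0) * ((∫ q, coneKernel r q.1 x * (q.2 j * q.2 k) ∂(empiricalMeasure w)) - mollMomentum r w x j * mollMomentum r w x k / mollDensity r w x) =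
      σ ^ 3 * (g (σ ^ 3 * mollDensity r w x) * Yt (σ ^ 3 * mollDensity r w x)) * ∑ j, ∑ k, (a j k (s, x) - if j = k then (∑ i, a i i (s, x)) / 3 else 0) * (mollDensity r w x * (∫ q, coneKernel r q.1 x * (q.2 j * q.2 k) ∂(empiricalMeasure w)) - mollMomentum r w x j * mollMomentum r w x k) := by
  have hb : 0 ≤ σ ^ 3 * mollDensity r w x := mul_nonneg (pow_nonneg hσ.le 3) (mollDensity_nonneg_of_pos hr w x)
  rw [max_eq_left hb]
  simp_rw [← mollDensity_mul_centralMoment hr, Finset.mul_sum]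
  refine Finset.sum_congr rfl fun j _ => Finset.sum_congr rfl fun k _ => ?_
  ring

/-- **The polynomial form is jointly continuous in `(s, x, w)`** for continuous `a, g, Ỹ`. [folklore] -/
theorem continuous_wsiPoly {σ r : ℝ} {a : Fin 3 → Fin 3 → ℝ × T3 → ℝ} {g Yt : ℝ → ℝ}
    (ha : ∀ j k, Continuous (a j k)) (hg : Continuous g) (hYt : Continuous Yt) :
    Continuous fun p : ℝ × T3 × Config (N + 1) (Fin 3) T3 =>
      σ ^ 3 * (g (σ ^ 3 * mollDensity r p.2.2 p.2.1) * Yt (σ ^ 3 * mollDensity r p.2.2 p.2.1)) * ∑ j, ∑ k, (a j k (p.1, p.2.1) - if j = k then (∑ i, a i i (p.1, p.2.1)) / 3 else 0) * (mollDensity r p.2.2 p.2.1 * (∫ q, coneKernel r q.1 p.2.1 * (q.2 j * q.2 k) ∂(empiricalMeasure p.2.2)) - mollMomentum r p.2.2 p.2.1 j * mollMomentum r p.2.2 p.2.1 k) := by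
  have ha' : ∀ j k, Continuous fun p : ℝ × T3 × Config (N + 1) (Fin 3) T3 => a j k (p.1, p.2.1) :=
    fun j k => (ha j k).comp (continuous_fst.prodMk continuous_snd.fst)
  refine (continuous_const.mul ((hg.comp (continuous_const.mul ?_)).mul (hYt.comp (continuous_const.mul ?_)))).mul
    (continuous_finsetSum _ fun j _ => continuous_finsetSum _ fun k _ => ?_)
  · fun_prop
  · fun_prop
  · refine Continuous.mul ((ha' j k).sub ?_) (by fun_prop)
    by_cases hjk : j = k
    · simp only [hjk, if_true]
      exact (continuous_finsetSum _ fun i _ => ha' i i).div_const _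
    · simp only [hjk, if_false]
      exact continuous_const

/-! ## Mark matching: the collision functional of the stress mark -/

/-- **The stress mark at a post-collisional pair is the `a`-weighted sum of the even marks.**  If `0 < ⟪n, vᵢ − vⱼ⟫`
(the recorded pair is outgoing), the recovered pre-collisional pair `(vᵢ⁻, vⱼ⁻) = reflectVel n (vᵢ, vⱼ)` approaches
(`inner_reflectVel_fst_sub_snd`), so `((vⱼ⁻ − vᵢ⁻)·n̂)₊ = |(vᵢ⁻ − vⱼ⁻)·n̂|` with `n̂ = ε⁻¹ n`. [folklore] -/
theorem stressMark_eq_sum_evenMark {ε : ℝ} {n vi vj : V3} (hout : 0 < ⟪n, vi - vj⟫_ℝ) (hε : 0 < ε) (c : ℝ)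
    (A : Fin 3 → Fin 3 → ℝ) :
    c * |⟪(reflectVel n (vi, vj)).1 - (reflectVel n (vi, vj)).2, ε⁻¹ • n⟫_ℝ| *
        ∑ k, ∑ l, A k l * ((ε⁻¹ • n) k * (ε⁻¹ • n) l) =
      ∑ k, ∑ l, A k l * c * evenMark k l (ε⁻¹ • n, (reflectVel n (vi, vj)).1, (reflectVel n (vi, vj)).2) := by
  have hn : n ≠ 0 := fun h => by
    rw [h, inner_zero_left] at hout
    exact lt_irrefl _ hout
  have h1 : ⟪(reflectVel n (vi, vj)).1 - (reflectVel n (vi, vj)).2, ε⁻¹ • n⟫_ℝ = -(ε⁻¹ * ⟪n, vi - vj⟫_ℝ) := by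
    rw [real_inner_smul_right, real_inner_comm, inner_reflectVel_fst_sub_snd n hn]
    ring
  have hneg : ⟪(reflectVel n (vi, vj)).1 - (reflectVel n (vi, vj)).2, ε⁻¹ • n⟫_ℝ < 0 := by
    rw [h1, neg_lt_zero]
    exact mul_pos (inv_pos.2 hε) hout
  have h2 : ∀ k l, evenMark k l (ε⁻¹ • n, (reflectVel n (vi, vj)).1, (reflectVel n (vi, vj)).2) =
      |⟪(reflectVel n (vi, vj)).1 - (reflectVel n (vi, vj)).2, ε⁻¹ • n⟫_ℝ| * ((ε⁻¹ • n) k * (ε⁻¹ • n) l) := by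
    intro k l
    unfold evenMark
    have hs : ⟪(reflectVel n (vi, vj)).2 - (reflectVel n (vi, vj)).1, ε⁻¹ • n⟫_ℝ =
        -⟪(reflectVel n (vi, vj)).1 - (reflectVel n (vi, vj)).2, ε⁻¹ • n⟫_ℝ := by
      rw [← inner_neg_left, neg_sub]
    rw [hs, max_eq_left (by linarith), abs_of_neg hneg]
  simp_rw [h2, Finset.mul_sum]
  refine Finset.sum_congr rfl fun k _ => Finset.sum_congr rfl fun l _ => ?_
  ring

/-- Commuting a double `Fin 3`-sum past a finite sum. [folklore] -/
theorem sum_sum_sum_comm {α : Type*} (T : Finset α) (f : Fin 3 → Fin 3 → α → ℝ) :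
    ∑ k, ∑ l, ∑ s ∈ T, f k l s = ∑ s ∈ T, ∑ k, ∑ l, f k l s :=
  calc ∑ k, ∑ l, ∑ s ∈ T, f k l s = ∑ k, ∑ s ∈ T, ∑ l, f k l s :=
        Finset.sum_congr rfl fun _ _ => Finset.sum_comm
    _ = ∑ s ∈ T, ∑ k, ∑ l, f k l s := Finset.sum_comm

/-- **MARK MATCHING on the good set**: the collision functional of the stress mark of `CollisionalPressureValueInBand`
(verbatim its `Kc` applied to its mark, in the vocabulary `mollDensity = ρm`) is the sum over `(k, l)` of the collision
sums `K_N[a_{kl} g Ξ_P^{kl}]` of `EvenStressEnskog` (weights `χ = a_{kl}`).  On a good orbit the collision times in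
`[0, t]` are finitely many (`locFinite`) and every recorded contact pair is post-collisional
(`isOutgoing_of_mem_contactSet`). [folklore] -/
theorem cpvCollision_eq_sum {σ : ℝ} (hσ : 0 < σ)
    (Φ : HardSphereFlow (Torus.geometry (Fin 3)) (hsDiameter σ N) (N + 1)) {z : Config (N + 1) (Fin 3) T3}
    (hz : z ∈ Φ.good) (t : ℝ) (a : Fin 3 → Fin 3 → ℝ × T3 → ℝ) (g : ℝ → ℝ) (r : ℝ) :
    let ε := hsDiameter σ N
    let G : Geometry (Fin 3) T3 := Torus.geometry (Fin 3)
    let γ : Config (N + 1) (Fin 3) T3 → ℝ → Config (N + 1) (Fin 3) T3 := fun z s => Φ.flow s z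
    let pv : Config (N + 1) (Fin 3) T3 → ℝ → Fin (N + 1) → Fin (N + 1) → V3 × V3 := fun z s i j =>
      reflectVel (G.sepVec (γ z s i).1 (γ z s j).1) ((γ z s i).2, (γ z s j).2)
    (ε / (N + 1 : ℝ) * ∑ᶠ (s : ℝ) (_ : s ∈ collisionTimes G ε (γ z) ∩ Set.Icc 0 t),
      ∑ i : Fin (N + 1), ∑ j : Fin (N + 1),
        (if i ≠ j ∧ ‖G.sepVec (γ z s i).1 (γ z s j).1‖ = ε then
          g (σ ^ 3 * mollDensity r (γ z s) (γ z s i).1) *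
            |⟪(pv z s i j).1 - (pv z s i j).2, ε⁻¹ • G.sepVec (γ z s i).1 (γ z s j).1⟫_ℝ| *
            ∑ k : Fin 3, ∑ l : Fin 3, a k l (s, (γ z s i).1) *
              ((ε⁻¹ • G.sepVec (γ z s i).1 (γ z s j).1) k * (ε⁻¹ • G.sepVec (γ z s i).1 (γ z s j).1) l)
        else 0)) =
      ∑ k, ∑ l, Literature.MathematicalPhysics.KineticTheory.collisionSum σ N Φ t (a k l) g (evenMark k l) r z := by
  have hε := hsDiameter_pos hσ N
  have htraj := Φ.isTrajectory z hz
  have hfin := htraj.locFinite 0 t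
  dsimp only [Literature.MathematicalPhysics.KineticTheory.collisionSum]
  simp_rw [finsum_mem_eq_finite_toFinset_sum _ hfin]
  simp only [← Finset.mul_sum]
  congr 1
  rw [sum_sum_sum_comm]
  refine Finset.sum_congr rfl fun s hs => ?_
  rw [sum_sum_sum_comm]
  refine Finset.sum_congr rfl fun i _ => ?_
  rw [sum_sum_sum_comm]
  refine Finset.sum_congr rfl fun j _ => ?_
  by_cases hc : i ≠ j ∧ ‖(Torus.geometry (Fin 3)).sepVec (Φ.flow s z i).1 (Φ.flow s z j).1‖ = hsDiameter σ N
  · simp only [if_pos hc]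
    have hmem : (fun s => Φ.flow s z) s ∈ contactSet (Torus.geometry (Fin 3)) (N + 1) (hsDiameter σ N) i j :=
      ⟨htraj.mem s, hc.2⟩
    have hout : 0 < ⟪(Torus.geometry (Fin 3)).sepVec (Φ.flow s z i).1 (Φ.flow s z j).1,
        (Φ.flow s z i).2 - (Φ.flow s z j).2⟫_ℝ :=
      htraj.isOutgoing_of_mem_contactSet hc.1 hmem
    exact stressMark_eq_sum_evenMark hout hε _ _
  · simp only [if_neg hc, Finset.sum_const_zero]

/-! ## Registered sub-goal -/

/-- **REGISTERED SUB-GOAL `stub_pressureValueMarkMatching`** of `stub_pressureValueOfEvenStress`: the mark matching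
`cpvCollision_eq_sum` on the good set (its `let`s spelled out). [folklore] -/
theorem stub_pressureValueMarkMatching : ∀ {N : ℕ} {σ : ℝ}, 0 < σ → ∀ (Φ : HardSphereFlow (Torus.geometry (Fin 3)) (hsDiameter σ N) (N + 1)) {z : Config (N + 1) (Fin 3) T3}, z ∈ Φ.good → ∀ (t : ℝ) (a : Fin 3 → Fin 3 → ℝ × T3 → ℝ) (g : ℝ → ℝ) (r : ℝ), hsDiameter σ N / (N + 1 : ℝ) * ∑ᶠ (s : ℝ) (_ : s ∈ collisionTimes (Torus.geometry (Fin 3)) (hsDiameter σ N) (fun s => Φ.flow s z) ∩ Set.Icc 0 t), ∑ i : Fin (N + 1), ∑ j : Fin (N + 1), (if i ≠ j ∧ ‖(Torus.geometry (Fin 3)).sepVec (Φ.flow s z i).1 (Φ.flow s z j).1‖ = hsDiameter σ N then g (σ ^ 3 * mollDensity r (Φ.flow s z) (Φ.flow s z i).1) * |⟪(reflectVel ((Torus.geometry (Fin 3)).sepVec (Φ.flow s z i).1 (Φ.flow s z j).1) ((Φ.flow s z i).2, (Φ.flow s z j).2)).1 - (reflectVel ((Torus.geometry (Fin 3)).sepVec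 (Φ.flow s z i).1 (Φ.flow s z j).1) ((Φ.flow s z i).2, (Φ.flow s z j).2)).2, (hsDiameter σ N)⁻¹ • (Torus.geometry (Fin 3)).sepVec (Φ.flow s z i).1 (Φ.flow s z j).1⟫_ℝ| * ∑ k : Fin 3, ∑ l : Fin 3, a k l (s, (Φ.flow s z i).1) * (((hsDiameter σ N)⁻¹ • (Torus.geometry (Fin 3)).sepVec (Φ.flow s z i).1 (Φ.flow s z j).1) k * ((hsDiameter σ N)⁻¹ • (Torus.geometry (Fin 3)).sepVec (Φ.flow s z i).1 (Φ.flow s z j).1) l) else 0) = ∑ k, ∑ l, Literature.MathematicalPhysics.KineticTheory.collisionSum σ N Φ t (a k l) g (evenMark k l) r z :=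
  fun hσ Φ _ hz t a g r => cpvCollision_eq_sum hσ Φ hz t a g r

end Summit.AtomisticToContinuum.HydrodynamicLimit.Theorems.ParityBandClosurePressureValue

end
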